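import Mathlib
import Summits.MatrixMultiplication.MatrixMultiplication.Theorems.SnSubsetDichotomyPolynomialSlackHubDyadic
import Summits.MatrixMultiplication.MatrixMultiplication.Theorems.SnSubsetDichotomyPolynomialSlackStubSplit
import Summits.MatrixMultiplication.MatrixMultiplication.Theorems.SnSubsetDichotomyPolynomialSlackSpreadLevelOne
import Literature.Combinatorics.Additive.TPPGroupAlgebra

/-!
# Two dense quotients: a DOMINANT column of the sparse profile gives the volume bound

Crux `Summit.MatrixMultiplication.MatrixMultiplication.Theses.SnSubsetDichotomy.PolynomialSlack`
(item `stmt-MatrixMultiplication-8306`), level-one programme, lead c8 (two dense quotients: a dominant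
column, i.e. a hub at an `S`-position certified LOCALLY, via the rotated triple), line transport-split-hull,
stub `volume_le_of_dominant_col`.

Setting: a TPP triple `S, T, U ⊆ S_n` (`n ≥ 4`) of non-empty sets with quotient profiles
`d_A(i,j) = #{(s,t) : t j = s i}/|S||T|`, `d_B(j,k) = #{(t,u) : u k = t j}/|T||U|`,
`d_C(k,i) = #{(u,s) : s i = u k}/|U||S|`, the heavy part `p_C = (d_C - 1/n)·[d_C ≥ θ_C]` of the sparse
profile `d_C` at a level `θ_C ≥ 16/n`, and a DOMINANT column `i` (an `S`-position): with the column heavy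
mass `ρ_i = Σ_k p_C(k,i)` and the column forced hits `Φ^i = Σ_k p_C(k,i)·Σ_j d_A(i,j) d_B(j,k)`,
`1 - ε ≤ ((n-1)/n)·ρ_i - (n-1)·Φ^i` with `0 < ε ≤ 1/(7776(1+log n)⁴)`.

Since `p_C ≤ d_C` termwise and the column sums of `d_C` are `1` (`sum_pairMarginal_fst`), `ρ_i ≤ 1`;
and `Φ^i ≥ 0`. Hence dominance gives the hub `ρ_i ≥ 1 - ε ≥ 1/2 =: τ` and the LOCAL forced-hit bound
`(n-1)Φ^i ≤ (n-1)/n - (1 - ε) ≤ ε`, `Φ^i ≤ ε/(n-1) ≤ 2ε/n`. The rest is the hub argument of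
`twoDense_colHub_volume` (file `…TwoDenseColHub`) at `τ = 1/2`, `η₀ = ε`: the ROTATED triple `(T, U, S)`
is again TPP (`TripleProductProperty.rotate`) with quotient profiles `(d_B, d_C, d_A)`; the hub position of
its third set `S` is `i`, the block of positions of its second set `U` is `J' = {k : d_C(k,i) ≥ θ_C}` and
the block of positions of its first set `T` is `I' = {j : d_A(i,j) ≥ 1/n²}`. The general hub lemma
`hub_volume_dyadic` applies with `q = (τ - 1/n)/2 ≥ 1/8` and `η = 3ε`:

* block weight: `Σ_{j ∈ I'} Σ_{k ∈ J'} d_B d_C d_A ≤ Σ_{k ∈ J'} d_C(k,i)·Σ_j d_A(i,j) d_B(j,k)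
  ≤ (16/15)·Φ^i ≤ (16/15)·2ε/n ≤ 3ε/n` (`d_C ≤ (16/15) p_C` on heavy cells, `p_C = 0` off them);
* hub mass: with `μ(v) = #{s : s i = v}/|S|`, `X(v) = #{u : u⁻¹v ∈ J'}/|U|`, `Y(v) = #{t : t⁻¹v ∈ I'}/|T|`
  one has `Σ μX = Σ_{k ∈ J'} d_C(k,i) ≥ ρ_i ≥ τ` (`sum_pairMarginal_col_block_eq`),
  `Σ μY = Σ_{j ∈ I'} d_A(i,j) ≥ 1 - n/n²` (`sum_pairMarginal_row_block_eq`, row sums of `d_A` are `1`),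
  `Σ μ = 1` (`sum_marginal_col`) and `XY ≥ X + Y - 1`, so `Σ μXY ≥ τ - 1/n = 2q`;
* `81(1+log n)⁴·3ε ≤ τ²/8 ≤ 2q²` from `1944(1+log n)⁴ε ≤ 1/4 = τ²`.

The conclusion `|T||U||S| ≤ C(1+log n)^{10} log²(6n!/(|T||U|))·n·3ε·B/q⁴` with `1/q⁴ ≤ 4096` and
`0 ≤ log(6n!/(|T||U|)) ≤ LL` (`|T||U| ≤ n!`, packing) is the claim (`3·4096 = 12288`).
-/

namespace Summit.MatrixMultiplication.MatrixMultiplication.Theorems.PolynomialSlack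

open scoped BigOperators
open Literature.Combinatorics.Additive (TripleProductProperty)

-- `Summit.<Summit>.<Problem>` is the tree's mandated summit-side namespace (CONVENTIONS §2); for
-- this single-conjunct summit the two coincide, so each declaration silences `dupNamespace`.
set_option linter.dupNamespace false

set_option maxHeartbeats 1600000 in
/-- **Two dense quotients: a dominant column.** For `n ≥ 4`, a bound `B` on the volumes of TPP triples
of `S_{n-1}`, a TPP triple `S, T, U ⊆ S_n` of non-empty sets with quotient profiles `dA, dB, dC`, heavy
part `pC = (dC - 1/n)·[dC ≥ θC]` (`θC ≥ 16/n`), `log(6n!/(|T||U|)) ≤ LL`, `0 < ε ≤ 1/(7776(1+log n)⁴)`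
and an `S`-position `i` whose column is DOMINANT,
`1 - ε ≤ ((n-1)/n)·Σ_k pC(k,i) - (n-1)·Σ_k pC(k,i)·Σ_j dA(i,j) dB(j,k)`:
`|S||T||U| ≤ 12288·9600²·9⁴·(1+log n)^{10}·LL²·ε·n·B` (the general hub lemma `hub_volume_dyadic` on
the rotated triple `(T, U, S)`, whose profiles are `(dB, dC, dA)`, at `τ = 1/2`, `η = 3ε`; the hub and
the forced-hit bound of column `i` are read off the dominance LOCALLY). [folklore] -/
theorem volume_le_of_dominant_col {n : ℕ} (hn : 4 ≤ n) (B : ℕ)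
    (hB : ∀ S' T' U' : Finset (Equiv.Perm (Fin (n - 1))), TripleProductProperty S' T' U' →
      S'.card * T'.card * U'.card ≤ B)
    {S T U : Finset (Equiv.Perm (Fin n))} (hTPP : TripleProductProperty S T U)
    (hS0 : S.Nonempty) (hT0 : T.Nonempty) (hU0 : U.Nonempty)
    (dA dB dC pC : Fin n → Fin n → ℝ)
    (hdA : ∀ i j, dA i j = (((S ×ˢ T).filter fun st => st.2 j = st.1 i).card : ℝ) / (S.card * T.card : ℕ))
    (hdB : ∀ j k, dB j k = (((T ×ˢ U).filter fun tu => tu.2 k = tu.1 j).card : ℝ) / (T.card * U.card : ℕ))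
    (hdC : ∀ k i, dC k i = (((U ×ˢ S).filter fun us => us.2 i = us.1 k).card : ℝ) / (U.card * S.card : ℕ))
    (θC : ℝ) (hθC : 16 / (n : ℝ) ≤ θC)
    (hpC : ∀ k i, pC k i = if θC ≤ dC k i then dC k i - 1 / n else 0)
    (LL : ℝ) (hLB : Real.log (6 * n.factorial / (T.card * U.card : ℕ)) ≤ LL)
    (i : Fin n) (ε : ℝ) (hε0 : 0 < ε) (hε : ε ≤ 1 / (7776 * (1 + Real.log n) ^ 4))
    (hdom : 1 - ε ≤ ((n : ℝ) - 1) / n * (∑ k : Fin n, pC k i) -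
      ((n : ℝ) - 1) * ∑ k : Fin n, pC k i * ∑ j : Fin n, dA i j * dB j k) :
    ((S.card * T.card * U.card : ℕ) : ℝ) ≤
      12288 * (9600 ^ 2 * 9 ^ 4) * (1 + Real.log n) ^ 10 * LL ^ 2 * ε * n * B := by
  classical
  /- 0. scalars; the hub level `τ = 1/2` -/
  have hn2le : 2 ≤ n := le_trans (by norm_num) hn
  have hnR : (4 : ℝ) ≤ n := by exact_mod_cast hn
  have hn0 : (0 : ℝ) < n := by linarith
  have hm0 : (0 : ℝ) < (n : ℝ) - 1 := by linarith
  have hn2 : (0 : ℝ) < (n : ℝ) ^ 2 := by positivity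
  have h1n : (0 : ℝ) < 1 / (n : ℝ) := by positivity
  have h2n : 2 / (n : ℝ) = 2 * (1 / n) := by ring
  have h14 : 1 / (n : ℝ) ≤ 1 / 4 := one_div_le_one_div_of_le (by norm_num) hnR
  have hG1 : (1 : ℝ) ≤ 1 + Real.log n := by
    linarith [Real.log_nonneg (show (1 : ℝ) ≤ n by linarith)]
  have hG0 : 0 < 1 + Real.log n := by linarith
  have hG41 : (1 : ℝ) ≤ (1 + Real.log n) ^ 4 := one_le_pow₀ hG1
  have hcS0 : (0 : ℝ) < S.card := by exact_mod_cast hS0.card_pos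
  have hcT0 : (0 : ℝ) < T.card := by exact_mod_cast hT0.card_pos
  have hcU0 : (0 : ℝ) < U.card := by exact_mod_cast hU0.card_pos
  obtain ⟨τ, hτdef⟩ : ∃ τ : ℝ, τ = 1 / 2 := ⟨_, rfl⟩
  have hτ : 2 / (n : ℝ) ≤ τ := by rw [hτdef, h2n]; linarith
  have hτ0 : 0 < τ := lt_of_lt_of_le (by positivity) hτ
  -- `ε ≤ 1/7776 ≤ 1/4`
  have hε4 : ε ≤ 1 / 4 := by
    refine hε.trans ?_
    rw [div_le_div_iff₀ (by positivity) (by norm_num : (0 : ℝ) < 4)]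
    linarith
  -- `1944(1+log n)⁴ε ≤ 1/4 = τ²`
  have hηq : 1944 * (1 + Real.log n) ^ 4 * ε ≤ τ ^ 2 := by
    have hG4' : (0 : ℝ) ≤ (1 + Real.log n) ^ 4 := by positivity
    have hGne : (1 + Real.log n) ≠ 0 := hG0.ne'
    have h1 : (1 + Real.log n) ^ 4 * ε ≤ 1 / 7776 := by
      calc (1 + Real.log n) ^ 4 * ε
          ≤ (1 + Real.log n) ^ 4 * (1 / (7776 * (1 + Real.log n) ^ 4)) :=
            mul_le_mul_of_nonneg_left hε hG4'
        _ = 1 / 7776 := by field_simp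
    calc 1944 * (1 + Real.log n) ^ 4 * ε = 1944 * ((1 + Real.log n) ^ 4 * ε) := by ring
      _ ≤ 1944 * (1 / 7776) := by linarith [h1]
      _ = τ ^ 2 := by rw [hτdef]; norm_num
  /- 1. profiles: nonnegativity, row sums of `dA`, column sums of `dC`, the heavy part `pC` -/
  have hdA0 : ∀ i' j, 0 ≤ dA i' j := fun i' j => by rw [hdA]; positivity
  have hdB0 : ∀ j k, 0 ≤ dB j k := fun j k => by rw [hdB]; positivity
  have hdC0 : ∀ k i', 0 ≤ dC k i' := fun k i' => by rw [hdC]; positivity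
  have hrowA : ∑ j : Fin n, dA i j = 1 := by
    have h := sum_pairMarginal_snd S T i
    have h' : ∑ j : Fin n, (((S ×ˢ T).filter fun st => st.2 j = st.1 i).card : ℝ) =
        ((S.card * T.card : ℕ) : ℝ) := by
      exact_mod_cast h
    rw [Finset.sum_congr rfl fun j _ => hdA i j, ← Finset.sum_div, h', div_self]
    push_cast
    exact (mul_pos hcS0 hcT0).ne'
  have hcolC : ∑ k : Fin n, dC k i = 1 := by
    have h := sum_pairMarginal_fst U S i
    have h' : ∑ k : Fin n, (((U ×ˢ S).filter fun us => us.2 i = us.1 k).card : ℝ) =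
        ((U.card * S.card : ℕ) : ℝ) := by
      exact_mod_cast h
    rw [Finset.sum_congr rfl fun k _ => hdC k i, ← Finset.sum_div, h', div_self]
    push_cast
    exact (mul_pos hcU0 hcS0).ne'
  have h16 : 16 * (1 / (n : ℝ)) ≤ θC := by rw [mul_one_div]; exact hθC
  have hpC0 : ∀ k i', 0 ≤ pC k i' := by
    intro k i'
    rw [hpC]
    split_ifs with h
    · linarith
    · exact le_rfl
  have hpCle : ∀ k i', pC k i' ≤ dC k i' := by
    intro k i'
    rw [hpC]
    split_ifs with h
    · linarith
    · exact hdC0 k i'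
  have hX0 : ∀ k i', 0 ≤ ∑ j : Fin n, dA i' j * dB j k := fun k i' =>
    Finset.sum_nonneg fun j _ => mul_nonneg (hdA0 i' j) (hdB0 j k)
  /- 2. the dominant column: `ρ_i = Σ_k pC k i ∈ [1 - ε, 1]`, so `ρ_i ≥ τ`, and `(n-1)Φ^i ≤ ε`,
    `Φ^i ≤ 2ε/n` -/
  have hρ0 : 0 ≤ ∑ k : Fin n, pC k i := Finset.sum_nonneg fun k _ => hpC0 k i
  have hρ1 : ∑ k : Fin n, pC k i ≤ 1 := by
    rw [← hcolC]; exact Finset.sum_le_sum fun k _ => hpCle k i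
  have hΦ0 : 0 ≤ ∑ k : Fin n, pC k i * ∑ j : Fin n, dA i j * dB j k :=
    Finset.sum_nonneg fun k _ => mul_nonneg (hpC0 k i) (hX0 k i)
  have hfrac0 : 0 ≤ ((n : ℝ) - 1) / n := div_nonneg hm0.le hn0.le
  have hfrac1 : ((n : ℝ) - 1) / n ≤ 1 := by rw [div_le_one hn0]; linarith
  have hfracρ : ((n : ℝ) - 1) / n * (∑ k : Fin n, pC k i) ≤ ∑ k : Fin n, pC k i :=
    mul_le_of_le_one_left hρ0 hfrac1
  have hfracρ' : ((n : ℝ) - 1) / n * (∑ k : Fin n, pC k i) ≤ ((n : ℝ) - 1) / n :=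
    mul_le_of_le_one_right hfrac0 hρ1
  have hmΦ : 0 ≤ ((n : ℝ) - 1) * ∑ k : Fin n, pC k i * ∑ j : Fin n, dA i j * dB j k :=
    mul_nonneg hm0.le hΦ0
  -- the hub at the `S`-position `i`
  have hi : τ ≤ ∑ k : Fin n, pC k i := by rw [hτdef]; linarith
  -- the local forced-hit bound
  have hΦε : ((n : ℝ) - 1) * ∑ k : Fin n, pC k i * ∑ j : Fin n, dA i j * dB j k ≤ ε := by linarith
  have hΦ' : ∑ k : Fin n, pC k i * ∑ j : Fin n, dA i j * dB j k ≤ 2 * ε / n := by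
    rw [le_div_iff₀ hn0]
    nlinarith [mul_nonneg hΦ0 (sub_nonneg.2 hnR)]
  /- 3. the data of the rotated hub lemma -/
  set J' : Finset (Fin n) := Finset.univ.filter (fun k => θC ≤ dC k i) with hJ'
  set I' : Finset (Fin n) := Finset.univ.filter (fun j => 1 / (n : ℝ) ^ 2 ≤ dA i j) with hI'
  set q : ℝ := (τ - 1 / n) / 2 with hq
  set η : ℝ := 3 * ε with hη
  have hq0 : 0 < q := by rw [hq]; linarith
  have hη0 : 0 < η := by rw [hη]; positivity
  have hτq : τ ≤ 4 * q := by rw [hq]; linarith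
  have hq8 : 1 / 8 ≤ q := by rw [hq, hτdef]; linarith
  -- links to the hub
  have h1n2 : 1 / (n : ℝ) ^ 2 ≤ 16 / n := by
    rw [div_le_div_iff₀ hn2 hn0]; nlinarith
  have hJw : ∀ k ∈ J', 1 / (n : ℝ) ^ 2 ≤ dC k i := by
    intro k hk
    have hk' : θC ≤ dC k i := (Finset.mem_filter.1 hk).2
    linarith
  have hIw : ∀ j ∈ I', 1 / (n : ℝ) ^ 2 ≤ dA i j := fun j hj => (Finset.mem_filter.1 hj).2
  -- on the heavy cells `dC ≤ (16/15) pC`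
  have hheavy : ∀ k ∈ J', dC k i ≤ 16 / 15 * pC k i := by
    intro k hk
    have hk' : θC ≤ dC k i := (Finset.mem_filter.1 hk).2
    rw [hpC, if_pos hk']
    linarith
  -- off the heavy cells `pC = 0`
  have hoff : ∀ (f : Fin n → ℝ), ∑ k ∈ J', pC k i * f k = ∑ k : Fin n, pC k i * f k := by
    intro f
    apply Finset.sum_subset (Finset.subset_univ _)
    intro k _ hk
    have hk' : ¬ θC ≤ dC k i := fun h => hk (Finset.mem_filter.2 ⟨Finset.mem_univ _, h⟩)
    rw [hpC, if_neg hk', zero_mul]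
  /- 4. the block weight `Σ_{j ∈ I'} Σ_{k ∈ J'} dB dC dA ≤ (16/15)Φ^i ≤ η/n` -/
  have hΨ' : ∑ j ∈ I', ∑ k ∈ J', dB j k * dC k i * dA i j ≤ η / n := by
    calc ∑ j ∈ I', ∑ k ∈ J', dB j k * dC k i * dA i j
        ≤ ∑ j : Fin n, ∑ k ∈ J', dB j k * dC k i * dA i j :=
          Finset.sum_le_univ_sum_of_nonneg fun j => Finset.sum_nonneg fun k _ =>
            mul_nonneg (mul_nonneg (hdB0 j k) (hdC0 k i)) (hdA0 i j)
      _ = ∑ k ∈ J', dC k i * ∑ j : Fin n, dA i j * dB j k := by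
          rw [Finset.sum_comm]
          refine Finset.sum_congr rfl fun k _ => ?_
          rw [Finset.mul_sum]
          exact Finset.sum_congr rfl fun j _ => by ring
      _ ≤ ∑ k ∈ J', 16 / 15 * pC k i * ∑ j : Fin n, dA i j * dB j k :=
          Finset.sum_le_sum fun k hk => mul_le_mul_of_nonneg_right (hheavy k hk) (hX0 k i)
      _ = 16 / 15 * ∑ k ∈ J', pC k i * ∑ j : Fin n, dA i j * dB j k := by
          rw [Finset.mul_sum]
          exact Finset.sum_congr rfl fun k _ => by ring
      _ = 16 / 15 * ∑ k : Fin n, pC k i * ∑ j : Fin n, dA i j * dB j k := by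
          rw [hoff (fun k => ∑ j : Fin n, dA i j * dB j k)]
      _ ≤ 16 / 15 * (2 * ε / n) := mul_le_mul_of_nonneg_left hΦ' (by norm_num)
      _ = (32 / 15 * ε) / n := by ring
      _ ≤ η / n := div_le_div_of_nonneg_right (by rw [hη]; linarith) hn0.le
  /- 5. the hub mass `Σ_v μ X Y ≥ τ - 1/n = 2q` -/
  -- `Σ_v μ = 1`
  have hμsum : ∑ v : Fin n, ((S.filter fun u => u i = v).card : ℝ) / S.card = 1 := by
    rw [← Finset.sum_div, sum_marginal_col S i, div_self hcS0.ne']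
  -- `Σ_v μ X = Σ_{k ∈ J'} dC k i ≥ τ`
  have hμX : ∑ k ∈ J', dC k i = ∑ v : Fin n, ((S.filter fun u => u i = v).card : ℝ) / S.card *
      (((U.filter fun t => t⁻¹ v ∈ J').card : ℝ) / U.card) := by
    have hcol := sum_pairMarginal_col_block_eq U S J' i
    have hcolR : ∑ k ∈ J', (((U ×ˢ S).filter fun us => us.2 i = us.1 k).card : ℝ) =
        ∑ v : Fin n, ((S.filter fun u => u i = v).card : ℝ) *
          ((U.filter fun t => t⁻¹ v ∈ J').card : ℝ) := by
      exact_mod_cast hcol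
    rw [Finset.sum_congr rfl fun k _ => hdC k i, ← Finset.sum_div, hcolR, Finset.sum_div]
    refine Finset.sum_congr rfl fun v _ => ?_
    rw [div_mul_div_comm, Nat.cast_mul, mul_comm (U.card : ℝ)]
  have hJsum : τ ≤ ∑ k ∈ J', dC k i := by
    calc τ ≤ ∑ k : Fin n, pC k i := hi
      _ = ∑ k : Fin n, pC k i * 1 := Finset.sum_congr rfl fun k _ => (mul_one _).symm
      _ = ∑ k ∈ J', pC k i * 1 := (hoff (fun _ => 1)).symm
      _ ≤ ∑ k ∈ J', dC k i := Finset.sum_le_sum fun k _ => by rw [mul_one]; exact hpCle k i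
  -- `Σ_v μ Y = Σ_{j ∈ I'} dA i j ≥ 1 - 1/n`
  have hμY : ∑ j ∈ I', dA i j = ∑ v : Fin n, ((S.filter fun u => u i = v).card : ℝ) / S.card *
      (((T.filter fun s => s⁻¹ v ∈ I').card : ℝ) / T.card) := by
    have hrow := sum_pairMarginal_row_block_eq S T I' i
    have hrowR : ∑ j ∈ I', (((S ×ˢ T).filter fun st => st.2 j = st.1 i).card : ℝ) =
        ∑ v : Fin n, ((S.filter fun u => u i = v).card : ℝ) *
          ((T.filter fun s => s⁻¹ v ∈ I').card : ℝ) := by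
      exact_mod_cast hrow
    rw [Finset.sum_congr rfl fun j _ => hdA i j, ← Finset.sum_div, hrowR, Finset.sum_div]
    refine Finset.sum_congr rfl fun v _ => ?_
    rw [div_mul_div_comm, Nat.cast_mul]
  have hIsum : 1 - 1 / (n : ℝ) ≤ ∑ j ∈ I', dA i j := by
    rw [hI', Finset.sum_filter]
    have h1 : ∀ j, dA i j - 1 / (n : ℝ) ^ 2 ≤ (if 1 / (n : ℝ) ^ 2 ≤ dA i j then dA i j else 0) := by
      intro j
      split_ifs with h
      · linarith [show (0 : ℝ) ≤ 1 / (n : ℝ) ^ 2 by positivity]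
      · linarith
    calc 1 - 1 / (n : ℝ) = ∑ j : Fin n, (dA i j - 1 / (n : ℝ) ^ 2) := by
          rw [Finset.sum_sub_distrib, hrowA, Finset.sum_const, Finset.card_univ, Fintype.card_fin,
            nsmul_eq_mul]
          field_simp
      _ ≤ _ := Finset.sum_le_sum fun j _ => h1 j
  -- pointwise `μ X Y ≥ μ X + μ Y - μ`
  have hpt : ∀ v : Fin n,
      ((S.filter fun u => u i = v).card : ℝ) / S.card *
            (((U.filter fun t => t⁻¹ v ∈ J').card : ℝ) / U.card) +
          ((S.filter fun u => u i = v).card : ℝ) / S.card *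
            (((T.filter fun s => s⁻¹ v ∈ I').card : ℝ) / T.card) -
          ((S.filter fun u => u i = v).card : ℝ) / S.card ≤
        ((S.filter fun u => u i = v).card : ℝ) / S.card *
          ((((U.filter fun t => t⁻¹ v ∈ J').card : ℝ) / U.card) *
            (((T.filter fun s => s⁻¹ v ∈ I').card : ℝ) / T.card)) := by
    intro v
    have hm : 0 ≤ ((S.filter fun u => u i = v).card : ℝ) / S.card :=
      div_nonneg (Nat.cast_nonneg _) (Nat.cast_nonneg _)
    have hx : ((U.filter fun t => t⁻¹ v ∈ J').card : ℝ) / U.card ≤ 1 :=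
      div_le_one_of_le₀ (by exact_mod_cast Finset.card_filter_le _ _) (Nat.cast_nonneg _)
    have hy : ((T.filter fun s => s⁻¹ v ∈ I').card : ℝ) / T.card ≤ 1 :=
      div_le_one_of_le₀ (by exact_mod_cast Finset.card_filter_le _ _) (Nat.cast_nonneg _)
    nlinarith [mul_nonneg hm (mul_nonneg (sub_nonneg.2 hx) (sub_nonneg.2 hy))]
  have hlow' : 2 * q ≤ ∑ v : Fin n, ((S.filter fun u => u i = v).card : ℝ) / S.card *
      ((((U.filter fun t => t⁻¹ v ∈ J').card : ℝ) / U.card) *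
        (((T.filter fun s => s⁻¹ v ∈ I').card : ℝ) / T.card)) := by
    calc 2 * q = τ + (1 - 1 / n) - 1 := by rw [hq]; ring
      _ ≤ ∑ k ∈ J', dC k i + ∑ j ∈ I', dA i j - 1 := by linarith
      _ = ∑ v : Fin n, (((S.filter fun u => u i = v).card : ℝ) / S.card *
              (((U.filter fun t => t⁻¹ v ∈ J').card : ℝ) / U.card) +
            ((S.filter fun u => u i = v).card : ℝ) / S.card *
              (((T.filter fun s => s⁻¹ v ∈ I').card : ℝ) / T.card) -
            ((S.filter fun u => u i = v).card : ℝ) / S.card) := by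
          rw [Finset.sum_sub_distrib, Finset.sum_add_distrib, ← hμX, ← hμY, hμsum]
      _ ≤ _ := Finset.sum_le_sum fun v _ => hpt v
  /- 6. `81(1+log n)⁴η ≤ 2q²` -/
  have hηq' : 81 * (1 + Real.log n) ^ 4 * η ≤ 2 * q ^ 2 := by
    have h4 : τ ^ 2 ≤ (4 * q) ^ 2 := pow_le_pow_left₀ hτ0.le hτq 2
    have hG4 : 0 ≤ (1 + Real.log n) ^ 4 := by positivity
    rw [hη]
    nlinarith
  /- 7. the general hub lemma on the rotated triple `(T, U, S)` -/
  have hmain := hub_volume_dyadic hn2le B hB hTPP.rotate hT0 hU0 hS0 dB dC dA hdB hdC hdA i J' I' q η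
    hq0 hη0 hJw hIw hlow' hΨ' hηq'
  /- 8. arithmetic: `η/q⁴ ≤ 3·4096·ε = 12288ε` -/
  have hperm : ((S.card * T.card * U.card : ℕ) : ℝ) = ((T.card * U.card * S.card : ℕ) : ℝ) := by
    push_cast; ring
  rw [hperm]
  refine hmain.trans ?_
  have hL0 : 0 ≤ Real.log (6 * n.factorial / (T.card * U.card : ℕ)) := by
    apply Real.log_nonneg
    have hTU : ((T.card * U.card : ℕ) : ℝ) ≤ n.factorial := by
      exact_mod_cast card_mul_card_le_factorial_of_injOn (injOn_quot_second hTPP hS0)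
    have hTU0 : (0 : ℝ) < ((T.card * U.card : ℕ) : ℝ) := by push_cast; positivity
    rw [le_div_iff₀ hTU0]
    linarith
  have hLL : (Real.log (6 * n.factorial / (T.card * U.card : ℕ))) ^ 2 ≤ LL ^ 2 :=
    pow_le_pow_left₀ hL0 hLB 2
  have hq4 : (1 : ℝ) ≤ 4096 * q ^ 4 := by
    have h := pow_le_pow_left₀ (by norm_num : (0 : ℝ) ≤ 1 / 8) hq8 4
    norm_num at h
    linarith
  have hLL0 : 0 ≤ LL ^ 2 := by positivity
  rw [div_le_iff₀ (by positivity), hη]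
  have hK : 0 ≤ (9600 : ℝ) ^ 2 * 9 ^ 4 * (1 + Real.log n) ^ 10 * n * ε * B := by positivity
  calc 9600 ^ 2 * 9 ^ 4 * (1 + Real.log n) ^ 10 *
        Real.log (6 * n.factorial / (T.card * U.card : ℕ)) ^ 2 * n * (3 * ε) * B
      = (9600 : ℝ) ^ 2 * 9 ^ 4 * (1 + Real.log n) ^ 10 * n * ε * B *
          (3 * (Real.log (6 * n.factorial / (T.card * U.card : ℕ)) ^ 2 * 1)) := by ring
    _ ≤ (9600 : ℝ) ^ 2 * 9 ^ 4 * (1 + Real.log n) ^ 10 * n * ε * B *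
          (3 * (LL ^ 2 * (4096 * q ^ 4))) := by
        refine mul_le_mul_of_nonneg_left (mul_le_mul_of_nonneg_left ?_ (by norm_num)) hK
        exact mul_le_mul hLL hq4 (by norm_num) hLL0
    _ = 12288 * (9600 ^ 2 * 9 ^ 4) * (1 + Real.log n) ^ 10 * LL ^ 2 * ε * n * B * q ^ 4 := by ring

end Summit.MatrixMultiplication.MatrixMultiplication.Theorems.PolynomialSlack
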